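import Summits.BirchSwinnertonDyer.Rank1Residual.Additive.RamifiedSevenGenusStarColumn
import Summits.BirchSwinnertonDyer.Rank1Residual.Additive.RamifiedSevenGenusEllipticUnitColumn
import HarnessLib

set_option autoImplicit false

/-!
# SCRATCH CERTIFICATE (not a tree file): row K2C-6 = CARRIER-1 assembled — (C1) + (C2) + (L-C3)/(C3) feed ONE
# constructor of `GenusSeven.PinnedKatoGenusFrame W K hK I d`; remaining binders = {facts ★, GZK, h159, hG} ∪
# {number-field / carrier parameters (THM elsewhere, kept as parameters because later binders depend on them)} ∪
# {`x` (unread), `hEU` = (C5) `EU_not_mem_of_residue` over the (C3) output spec}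

Cell `bsd-cm`, seat `bsd-cm-k-ty1` g29 (literature-prover; pen D1007 (B) WELCOME / D1012).  This is g34's
`bsd-cm-prr-ty1/g34/ScratchC1C2Frame.lean` final `example` with the tree files (C1) `RamifiedSevenGenusCarrierAlgebra`
(p798180), (C2) `RamifiedSevenGenusStarColumn` (p798933) IMPORTED instead of inlined, and the (C3) column binders
`ψ hψ hL hcond Ω hΩ 𝔏 euK euK_spec EU EU_mem EU_eq hlay` DISCHARGED by
`EllipticUnitColumn.exists_ellipticUnitColumn_of_frame` (p798199, over (L-C3) p798022), `CarrierAlgebra.ιS_mem` and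
`NumberFieldColumn.isRayClassLayer_layer_baseChange`.  New binders relative to g34's: `h159`, `hG` (the two named facts the
(C3) column is conditional on), `c`/`hc` (complex conjugation of `Kcm`, input of (C3)).  `hEU` is (C5) stated over the
(C3) OUTPUT SPEC (universally in `ψ Ω 𝔏 euK` with their four properties), since `euK` is produced inside the proof.
HONEST LABEL: a type-checking certificate only; it closes nothing; stmt-BirchSwinnertonDyer-19945 OPEN; K2ᶜ-inhabitation
NOT done (GAP = `hEU` (C5), `x` unread, facts ★/GZK/h159/hG); `X12.CMRamifiedSeven` NOT proved; no summit statement is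
proved; BSD claimed for no curve.
-/

noncomputable section

open scoped NumberField TensorProduct
open Field
open Literature.NumberTheory.GaloisRepresentations
open Literature.NumberTheory.EllipticCurves
open Literature.NumberTheory.EllipticCurves.Kato2004
open Literature.NumberTheory.ComplexMultiplication.EllipticUnits
open Literature.NumberTheory.EllipticCurves.Rank1Residual
open Summit.BirchSwinnertonDyer.Rank1Residual
open Summit.BirchSwinnertonDyer.Rank1Residual.Additive.GenusSeven

example (hstar : exists_zetaClassPosition_of_rank_le_one) (hGZK : rank_eq_analyticRank_of_analyticRank_le_one)
    (h159 : CM.prop159_ellipticUnits_expStar_values) (hG : Gross_conductorExponent_baseChange_eq_two_mul)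
    (W : WeierstrassCurve ℚ) [W.IsElliptic] [W.IsGloballyMinimal] [Fact (Nat.Prime 7)] (hC : X12.ClassCSeven W)
    [ContinuousSMul ℤ_[7] (W.tateModule 7)] (K : ZpExtension ℚ 7) (hK : K.IsCyclotomic)
    {γ : absoluteGaloisGroup ℚ} (hγ : K.IsTopGenerator γ) (I : IwasawaH1Data W 7 K γ)
    {F : GenusFrame} {θu : ∀ n : ℕ, globalUnitsOf (F.layer n)} (d : GenusDatum F θu)
    -- number-field block and carrier inputs (THM elsewhere: `NumberFieldColumn.exists_*`, `CarrierAlgebra.exists_carrier_inputs`,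
    -- `CMIsogeny.exists_cmIsogeny_sq_eq_neg_seven`; kept as parameters because `x`/`hEU` depend on them)
    (Kcm : Type) [Field Kcm] [NumberField Kcm] (h2 : Module.finrank ℚ Kcm = 2) (s : Kcm) (hs : s ^ 2 = -7)
    (c : Kcm ≃ₐ[ℚ] Kcm) (hc : c ≠ 1) (ιC : AlgebraicClosure Kcm →+* ℂ)
    (hιC : ∀ (w : NumberField.InfinitePlace Kcm) (x : Kcm), ιC (algebraMap Kcm (AlgebraicClosure Kcm) x) = w.embedding x)
    (𝔣 : Ideal (𝓞 Kcm)) (h𝔣1 : Ideal.absNorm 𝔣 = 7 * F.d ^ 2) (h𝔣2 : 𝔣 ∣ Ideal.span {((7 * F.D : ℤ) : 𝓞 Kcm)})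
    (𝔞 : Ideal (𝓞 Kcm)) (h𝔞1 : IsTwist 7 𝔣 𝔞) (h𝔞2 : Ideal.absNorm 𝔞 = F.normA)
    (hbad : ∀ (q : ℕ) [Fact q.Prime], q ≠ 7 → (¬ Good W q ↔ q ∣ F.d))
    [instK : ContinuousSMul ℤ_[7] ((W.baseChange Kcm).tateModule 7)]
    (γK : absoluteGaloisGroup Kcm) (hγK : (K.restrictOfFinrankEqTwo (by decide) Kcm h2).IsTopGenerator γK)
    (IK : IwasawaH1DataOver (W.baseChange Kcm) 7 (K.restrictOfFinrankEqTwo (by decide) Kcm h2) γK)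
    (φ : WeierstrassCurve.Isogeny (W.baseChange Kcm) (W.baseChange Kcm)) (φ_sq : ∀ P, φ (φ P) = (-7 : ℤ) • P)
    -- the two GAP binders: `x` (unread by any consumer) and (C5) over the (C3) output spec
    (x : Ideal (𝓞 Kcm) → QuadOrder (IwasawaAlgebra 7) (-7))
    (hEU : ∀ (ψ : HeckeCharacter Kcm) (Ω : ℂ)
        (𝔏 : ∀ U : Subgroup (absoluteGaloisGroup Kcm),
          H1 (CM.tateRepK (W.baseChange Kcm) 7) U →ₗ[ℤ_[7]] ℚ_[7] ⊗[ℤ] AlgebraicClosure Kcm)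
        (euK : Ideal (𝓞 Kcm) → IK.H),
        ψ.HasInfinityType (fun _ ↦ 1) (fun _ ↦ 0) →
        (∀ z : ℂ, 3 / 2 < z.re → heckeLFunction ψ z = W.LSeries z) →
        (∀ α : 𝓞 Kcm, α ≠ 0 → ((7 * F.d : ℕ) : 𝓞 Kcm) ∣ α - 1 →
          CM.heckeCharIdealValue ψ (Ideal.span {α}) = ιC (algebraMap Kcm (AlgebraicClosure Kcm) (α : Kcm))) →
        Ω ≠ 0 →
        (∀ 𝔟 : Ideal (𝓞 Kcm), IsTwist 7 𝔣 𝔟 →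
          ∃ (w : ∀ U : Subgroup (absoluteGaloisGroup Kcm), H1 (CM.tateRepK (W.baseChange Kcm) 7) U)
            (y : Subgroup (absoluteGaloisGroup Kcm) → AlgebraicClosure Kcm),
            CM.EllipticZetaBody Kcm (W.baseChange Kcm) 7 ψ (7 * F.d) ιC Ω 𝔏 𝔟 w y ∧
            ∀ n : ℕ, IK.proj n (euK 𝔟) = w ((K.restrictOfFinrankEqTwo (by decide) Kcm h2).layerSubgroup n)) →
        letI := IK.cmModule hγK φ φ_sq; letI := IK.cmModuleRat hγK φ φ_sq;
        GenusResidueNonzeroShape d → ¬ ∃ y ∈ LinearMap.range (IK.toRat hγK φ φ_sq),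
          LocalizedModule.mkLinearMap (Submonoid.powers (7 : IwasawaAlgebra 7)) IK.H (euK 𝔞) =
            (QuadOrder.ϖ : QuadOrder (IwasawaAlgebra 7) (-7)) • y) :
    Nonempty (PinnedKatoGenusFrame W K hK I d) := by
  letI instR : Module (QuadOrder (IwasawaAlgebra 7) (-7)) IK.ratH := IK.cmModuleRat hγK φ φ_sq
  letI := IK.cmModule hγK φ φ_sq
  -- (C2): the ★-column
  obtain ⟨zOne, k, hpos, hj⟩ := StarColumn.exists_star_column hstar hGZK W hC hK hγ I h2 IK hγK φ φ_sq
  -- (C3): the elliptic-unit column (ψ, Ω, 𝔏, euK and their four properties), over (L-C3)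
  obtain ⟨ψ, Ω, 𝔏, euK, hψ, hL, hcond, hΩ, heuK⟩ :=
    EllipticUnitColumn.exists_ellipticUnitColumn_of_frame h159 hG hC F hbad Kcm h2 s hs c hc ιC hιC K hK IK 𝔣 h𝔣1 h𝔣2
  exact ⟨{
    Kcm := Kcm
    finrank_Kcm := h2
    sqrtNegSeven := s
    sqrtNegSeven_sq := hs
    𝔣 := 𝔣
    absNorm_𝔣 := h𝔣1
    𝔣_dvd := h𝔣2
    𝔞 := 𝔞
    isTwist_𝔞 := h𝔞1
    absNorm_𝔞 := h𝔞2
    R := QuadOrder (IwasawaAlgebra 7) (-7)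
    π := QuadOrder.ϖ
    v := -1
    seven_eq := CarrierAlgebra.seven_eq
    A := IK.ratH
    instModule := IK.cmModuleRat hγK φ φ_sq
    instTower := CarrierAlgebra.isScalarTower h2 W K IK hγK φ φ_sq
    torsionFree_π := CarrierAlgebra.torsionFree_π h2 W K IK hγK φ φ_sq
    frame := { HS := LinearMap.range (IK.toRat hγK φ φ_sq)
               zeta := (LocalizedModule.mk (I.resOver IK hγ hγK zOne)
                 (⟨(7 : IwasawaAlgebra 7) ^ k, k, rfl⟩ : Submonoid.powers (7 : IwasawaAlgebra 7)) : IK.ratH)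
               x := x
               EU := fun 𝔟 => LocalizedModule.mkLinearMap (Submonoid.powers (7 : IwasawaAlgebra 7)) IK.H (euK 𝔟)
               EU_mem := fun 𝔟 => CarrierAlgebra.ιS_mem h2 W K IK hγK φ φ_sq (euK 𝔟) }
    j := LocalizedModule.mkLinearMap (Submonoid.powers (7 : IwasawaAlgebra 7)) IK.H ∘ₗ I.resOver IK hγ hγK
    j_mem := CarrierAlgebra.j_mem h2 W K I hγ IK hγK φ φ_sq
    zS := (LocalizedModule.mk (I.resOver IK hγ hγK zOne)
      (⟨(7 : IwasawaAlgebra 7) ^ k, k, rfl⟩ : Submonoid.powers (7 : IwasawaAlgebra 7)) : IK.ratH)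
    u := 1
    a := 0
    a_le_one := StarColumn.a_le_one
    t := 1
    zeta_eq := StarColumn.zeta_eq h2 W K I hγ IK hγK φ φ_sq zOne k
    zOne := zOne
    k := k
    zOne_pos := hpos
    j_zOne := hj
    EU_not_mem_of_residue := hEU ψ Ω 𝔏 euK hψ hL hcond hΩ heuK
    bad_iff_dvd := hbad
    γK := γK
    isTopGenerator_γK := hγK
    IK := IK
    ιS := LocalizedModule.mkLinearMap (Submonoid.powers (7 : IwasawaAlgebra 7)) IK.H
    ιS_injective := CarrierAlgebra.ιS_injective h2 W K IK
    mem_HS_iff := CarrierAlgebra.mem_HS_iff h2 W K IK hγK φ φ_sq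
    j_eq := CarrierAlgebra.j_eq h2 W K I hγ IK hγK
    φ := φ
    φ_sq := φ_sq
    proj_pi := CarrierAlgebra.proj_pi h2 W K IK hγK φ φ_sq
    ψ := ψ
    ψ_infinityType := hψ
    ψ_LSeries := hL
    ιC := ιC
    ιC_infinitePlace := hιC
    ψ_conductor := hcond
    Ω := Ω
    Ω_ne_zero := hΩ
    𝔏 := 𝔏
    isRayClassLayer_layer := NumberFieldColumn.isRayClassLayer_layer_baseChange h2 K hK W F.d
    euK := euK
    euK_spec := heuK
    EU_eq := fun _ _ => rfl }⟩

end
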